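import Literature.NumberTheory.Rogawski1990.TestFunctions
import Literature.NumberTheory.Automorphic.UnitaryGroupPureTensorContinuity
import Literature.NumberTheory.Automorphic.HarishChandraDiracGL
import HarnessLib

/-!
# Smooth pure tensors exist: the test-function class of the ENGINE T1 kit is non-empty
# ([Rogawski1990] §14.2 — `f′ = ⊗ f′_v ∈ C_c^∞(G′(𝔸))` with `f′_v = 1_{K_v}` for almost all `v`)

Topic `NumberTheory/Rogawski1990`; namespace `Literature.NumberTheory.Automorphic.UnitaryGroup`. Proof file: theorems only, no
definition, no named fact, no `sorry`; imports = tree + Mathlib.  Brick B14 of the P3a cell (F0P3a-plan (g0) 2026-08-30T23:31:20Z);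
HC_CM is proved only modulo the printed citations until rung 0 closes.

The ENGINE T1 line pins the kit's `Smooth f′` to «`f′` is the evaluation of a pure tensor `T : PureTensor L N H` with `T.IsTest`»
(★ `Rogawski1990/TestFunctions` ed. 2: `IsUnramified ∧ IsFinSmooth ∧ IsArchTest`) and its non-vacuity head quantifies
`∀ f′, Smooth f′ → …`; this file proves that such `f′ ≠ 0` EXIST, so «Smooth» is not the empty class:

* `exists_archBump` — an ARCHIMEDEAN BUMP on `GL_N(L ⊗_ℚ ℝ)`: a continuous, compactly supported function, smooth along every
  exponential chart `X ↦ g · exp X` (★ `IsArchSmooth` for ★ `archGroupGL`), equal to `1` at the identity — the tree's invariant bump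
  ★ `archBump` of a `ContDiffBump` composed with the Hilbert–Schmidt form (★ `archBump_mem_admissibleWeightsGL`, Borel (1972) 3.4);
* `PureTensor.exists_isTest_eval_one_ne_zero` — the pure tensor `1_{U(H)(𝒪̂)} ⊗ (bump ∘ incl)` (★ `PureTensor.ofUnramified` with EMPTY bad
  set and the bump restricted along `U(H)(L⁺ ⊗ ℝ) ≤ GL_N(L ⊗ ℝ)`) is `IsTest` and takes the value `1` at `1`;
* `PureTensor.exists_isTest_toCc_apply_one_ne_zero`, `exists_compactlySupported_isTest_ne_zero` — the same tensor as an element of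
  `C_c(U(H)(𝔸_{L⁺}), ℂ)` (★ `PureTensor.toCc`, F0P3a-p03's `UnitaryGroupPureTensorContinuity`): a NON-ZERO compactly supported continuous
  function of the form `T.eval` with `T.IsTest` — the witness the line's `anchoredKit_smooth_nonempty` needs.

## References
* [Rogawski1990] J. Rogawski, Ann. of Math. Stud. 123 (1990), §14.2 p. 233 (`f′ = ⊗ f′_v`, `f′_v = 1_{K_v}` off `S`).
* [BorelJacquet1979] A. Borel, H. Jacquet, Corvallis PSPM 33.1 (1979), §4.1 (smooth compactly supported functions on `G(𝔸)`).
* [Borel1972] A. Borel, *Représentations de groupes localement compacts*, LNM 276 (1972), 3.4 (Dirac sequences of smooth bumps).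
-/

set_option autoImplicit false

noncomputable section

open NumberField NumberField.mixedEmbedding IsDedekindDomain
-- `Classical`: the place subtypes indexing `mixedSpace L` are `Fintype` classically (`NormedCommRing (mixedSpace L)`)
open scoped MatrixGroups Classical

namespace Literature.NumberTheory.Automorphic.UnitaryGroup

variable (L : Type) [Field L] [NumberField L] [IsCMField L] (N : ℕ) (H : Matrix (Fin N) (Fin N) L)

open scoped Matrix.Norms.Operator in
omit [IsCMField L] in
/-- **An archimedean bump on `GL_N(L ⊗ ℝ)`**: a continuous, compactly supported `φ : GL_N(L ⊗_ℚ ℝ) → ℂ`, smooth along the exponential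
charts (★ `IsArchSmooth (archGroupGL N L).carrier.subtype`), with `φ 1 = 1` — the tree's invariant bump `x ↦ β(Q(x − 1)) β(Q(x⁻¹ − 1))`
(★ `archBump`, `β` a `ContDiffBump` at `0`, `Q` the Hilbert–Schmidt form), supported in a compact ball of invertible matrices
(★ `exists_closedBall_subset_range_val`, ★ `exists_hsQ_lt_imp_norm_lt`, ★ `archBump_mem_admissibleWeightsGL`).
[cite: Borel1972, 3.4] [cite: BorelJacquet1979, §4.1] -/
theorem exists_archBump :
    ∃ φ : GL (Fin N) (mixedSpace L) → ℂ, Continuous φ ∧ HasCompactSupport φ ∧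
      IsArchSmooth (archGroupGL N L).carrier.subtype φ ∧ φ 1 = 1 := by
  obtain ⟨ε₀, hε₀, hball⟩ := exists_closedBall_subset_range_val (n := N) (K := L)
  obtain ⟨r₀, hr₀, hr₀ε⟩ := exists_hsQ_lt_imp_norm_lt (n := N) (K := L) hε₀
  let β : ContDiffBump (0 : ℝ) := ⟨r₀ / 2, r₀, half_pos hr₀, half_lt_self hr₀⟩
  have hmem := archBump_mem_admissibleWeightsGL (n := N) (K := L) β 1 hε₀.le hball (fun z hz => hr₀ε z hz)
  obtain ⟨hc, hs, hsm, -, -⟩ := (mem_admissibleWeightsGL_iff _).1 hmem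
  refine ⟨_, hc, hs, hsm, ?_⟩
  simp only [one_mul, archBump_one, Complex.ofReal_one]

variable {L N H} in
/-- For an unramified element (in particular `1`) and EMPTY bad set, `eval` is the archimedean factor. [cite: Rogawski1990, §14.2 p. 233] -/
theorem PureTensor.eval_ofUnramified_empty_one
    (locS : ∀ v : HeightOneSpectrum (𝓞 ↥(maximalRealSubfield L)), (cmDatum L N H).Local v → ℂ)
    (f : UnitaryGroup.arch (↥(maximalRealSubfield L)) L (IsCMField.complexConj L) N H → ℂ) :
    (PureTensor.ofUnramified L N H ∅ locS f).eval 1 = f 1 := by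
  have h : ∀ v ∉ (PureTensor.ofUnramified L N H ∅ locS f).S,
      (cmDatum L N H).toLocal v 1 ∈ (PureTensor.ofUnramified L N H ∅ locS f).K v := fun v _ => by
    rw [map_one]
    exact Subgroup.one_mem _
  rw [PureTensor.eval_eq_of_forall_mem _ _ h, PureTensor.ofUnramified_S, Finset.prod_empty, mul_one]
  show f _ = f 1
  congr 1
  exact map_one _

/-- **A smooth pure tensor with `eval 1 ≠ 0` exists** on `U(H)(𝔸_{L⁺})`, for every `N` and every `H`: take the EMPTY bad set, the integral
levels `U(H)(𝒪_v)` everywhere (★ `PureTensor.ofUnramified`) and, at infinity, the archimedean bump of `exists_archBump` restricted along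
`U(H)(L⁺ ⊗ ℝ) ≤ GL_N(L ⊗ ℝ)` — the function `1_{U(H)(𝒪̂)} ⊗ φ|_{U(H)_∞}` of [Rogawski1990] §14.2's class. [cite: Rogawski1990, §14.2 p. 233]
[cite: BorelJacquet1979, §4.1] -/
theorem PureTensor.exists_isTest_eval_one_ne_zero :
    ∃ T : PureTensor L N H, T.IsTest ∧ T.eval 1 ≠ 0 := by
  obtain ⟨φ, hc, hs, hsm, h1⟩ := exists_archBump L N
  let f : UnitaryGroup.arch (↥(maximalRealSubfield L)) L (IsCMField.complexConj L) N H → ℂ :=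
    fun k => φ (k : GL (Fin N) (mixedSpace L))
  refine ⟨PureTensor.ofUnramified L N H ∅ (fun _ _ => 0) f,
    ⟨PureTensor.ofUnramified_isUnramified _ _ _,
      PureTensor.ofUnramified_isFinSmooth f (fun v hv => absurd hv (Finset.notMem_empty v)),
      ⟨φ, hc, hs, hsm, fun _ => rfl⟩⟩, ?_⟩
  rw [PureTensor.eval_ofUnramified_empty_one]
  show φ ((1 : UnitaryGroup.arch (↥(maximalRealSubfield L)) L (IsCMField.complexConj L) N H) :
    GL (Fin N) (mixedSpace L)) ≠ 0
  rw [OneMemClass.coe_one, h1]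
  exact one_ne_zero

/-- **The same tensor in `C_c(U(H)(𝔸_{L⁺}), ℂ)`** (★ `PureTensor.toCc`: the side conditions are discharged from `IsTest` by ★
`IsArchTest.continuous_arch ∕ hasCompactSupport_arch`, ★ `continuous_loc ∕ hasCompactSupport_loc`): its value at `1` is non-zero.
[cite: Rogawski1990, §14.2 p. 233] [cite: BorelJacquet1979, §4.1] -/
theorem PureTensor.exists_isTest_toCc_apply_one_ne_zero :
    ∃ (T : PureTensor L N H) (hT : T.IsTest),
      T.toCc hT.isUnramified hT.isArchTest.continuous_arch hT.isArchTest.hasCompactSupport_arch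
        (fun v _ => PureTensor.continuous_loc hT.isUnramified hT.isFinSmooth v)
        (fun v _ => PureTensor.hasCompactSupport_loc hT.isUnramified hT.isFinSmooth v) 1 ≠ 0 := by
  obtain ⟨T, hT, h1⟩ := PureTensor.exists_isTest_eval_one_ne_zero L N H
  exact ⟨T, hT, by rwa [PureTensor.toCc_apply]⟩

/-- **Non-vacuity of the kit's «Smooth»**: there is a NON-ZERO `f′ ∈ C_c(U(H)(𝔸_{L⁺}), ℂ)` of the form `⇑f′ = T.eval` with `T.IsTest`
(and `f′ 1 ≠ 0`) — the witness for the ENGINE T1 line's `Smooth f′ ↔ ∃ T, T.IsTest ∧ ⇑f′ = T.eval` (ed. 1.10, fix F3).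
[cite: Rogawski1990, §14.2 p. 233] [cite: BorelJacquet1979, §4.1] -/
theorem exists_compactlySupported_isTest_ne_zero :
    ∃ f' : CompactlySupportedContinuousMap (cmDatum L N H).Adelic ℂ,
      (∃ T : PureTensor L N H, T.IsTest ∧ ⇑f' = T.eval) ∧ f' 1 ≠ 0 ∧ f' ≠ 0 := by
  obtain ⟨T, hT, h1⟩ := PureTensor.exists_isTest_toCc_apply_one_ne_zero L N H
  refine ⟨_, ⟨T, hT, rfl⟩, h1, fun h0 => h1 ?_⟩
  rw [h0]
  rfl

end Literature.NumberTheory.Automorphic.UnitaryGroup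

end
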